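import Summits.BirchSwinnertonDyer.BirchSwinnertonDyer.Theorems.ErratumRoadFiveNonSurjCornerTwinLeaf
import Summits.BirchSwinnertonDyer.BirchSwinnertonDyer.Theorems.ClassRecordThreeCornerAtThreeChaStructureOfNeg
import Summits.BirchSwinnertonDyer.BirchSwinnertonDyer.Theorems.ErratumRoadFiveNonSurjCornerShimuraInertImageInputs
import Literature.NumberTheory.EllipticCurves.NonvanishingTwistsPrescribedSplitting
import HarnessLib

/-!
# Route `ErratumRoadFive` (rung K2), crux `NonSurjCorner` (item stmt-BirchSwinnertonDyer-19065), registered line `Lines/hybrid.lean`: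
# THE MAX ROAD WITHOUT CHA'S FACT — Cha 2005 Rmk. 25 (upper half, the XL structural named input `hChaU` of the X₀(N) MAX form, flag
# `Cha05-Rmk25-structure`) REPLACED by lane B corner3-p2 g11's KERNEL structure bound for irreducible images with `−1 ∈ ρ̄`
# (cell `bsd-stepL`, seat `bsd-stepL-corner-p1` g17; `--supports stmt-BirchSwinnertonDyer-19065 --as helper`)

WHY THIS FILE. On the hybrid line the upper half at `t = 0` ∕ mono-carrier corner pairs is the X₀(N) MAX road (this seat g3's
`missingUpperBoundAt_corner_of_jetchevDivisibility_of_twinLeafLower`), whose one structural named input is Cha 2005 Rmk. 25 in the upper form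
`Cha2005.rmk25_padicValNat_card_sha_primary_add_le_of_globalDivisibility` (conjunct 16 of r11's sixteen-fact slot 3). corner3-p2 g11 proved that bound
IN THE KERNEL (p628321 `ModularHeegnerCha.cha_rmk25_upper_of_neg_of_casselsTate_of_frobeniusCongruence`, p-generic: from `casselsTate_levelInputs K` and
the image-free Gross 3.7 (2), for every irreducible `E[p]` with `−1 ∈ ρ̄_{E,p}(Γ_ℚ)`, on Heegner frames with `d_K ∉ {−3,−4}` and `2` not inert) and
handed the corner instance to this seat (STATUS 11:19:10Z). THIS FILE plugs it in:
* §0 `not_isPrime_span_two_of_satisfiesHeegnerHypothesis` — «2 split ⟹ (2) not prime» (bookkeeping);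
* §1 `shaIndexBound_sharp_of_globalDivisibility_of_chaAt` — lane A's sharp `K`-bound with Cha's conclusion SUPPLIED AT THE FRAME (hypothesis shape)
  instead of the global named fact;
* §2 `missingUpperBoundAt_corner_of_jetchevDivisibility_of_twinLeafLower_of_casselsTate` — g3's MAX-road theorem with `hChaU ↦ {hCT, Gross 3.7 (2)}`:
  the frame is the Friedberg–Hoffstein Heegner field with `p` AND `2` split (finite-set FH, `exists_heegnerField_split_two_primes_twist_ne_zero`), `−1 ∈ ρ̄`
  from `ShimuraKolyvaginOfImage.exists_smul_eq_neg_of_mult_of_irr_of_five_le` (image-free, `p ≥ 5` multiplicative, `E[p]` irreducible);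
* §3 `X11b.erratumRoadFive_nonSurjCorner_of_kolyZShaAn_of_kolyJMax_of_multiUpper_of_lowerLeafTwinDeep_of_twinMultDivisibility_of_casselsTate` — g16's
  §1′ hybrid cut (`…HybridTwinLowerSupply`) with the same replacement (and the one-prime FH fact DERIVED from the finite-set one for its other uses).
EFFECT (glue #16 ∕ r14): slot 3 shrinks 16 → 15 — conjunct 16 (Cha upper) LEAVES the line, conjunct 8 (FH one-prime) is UPGRADED to the finite-set
Friedberg–Hoffstein fact (FH 1995 Thm. B as printed; strictly stronger as typed, same source); `casselsTate_levelInputs` and Gross 3.7 (2) are already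
conjuncts of slot 5. The lower direction (`Cha2005.rmk25_pow_dvd_card_sha_primary_of_certificate`, conjunct 15) is untouched.

HONEST FRAMING: THEOREMS ONLY (no definition, no named fact, no `sorry`); CONDITIONAL on the displayed binders; nothing here is a BSD class theorem;
no census label moves (T7); 19065 NOT closed; BSD is proved for no curve. Credit: lane B corner3-p2 g11 (the Cha kernel), tam3-p1 ∕ lane A x11b3
(the sharp K-bound), shim seats (image-free leaves), this seat g3∕g8∕g16.
References (locators only): [cite: Cha2005, Thm. 21 and Rmk. 25 (pp. 173–175)] [cite: MatarNekovar2019, Thm. 0.7, §0.9, §0.11] [cite: McCallumLMS1991, §5 Cor. 5.6]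
[cite: GrossLMS1991, §3 Prop. 3.7 (2), §9 Prop. 9.3] [cite: FriedbergHoffstein1995, Thm. B] [cite: JetchevSkinnerWan2017, §7.4.1–7.4.2] [cite: Miller2011LMS, Def. 1.1].
-/

set_option autoImplicit false
set_option linter.dupNamespace false -- `Summit.BirchSwinnertonDyer.BirchSwinnertonDyer` (summit = problem), tree-wide

noncomputable section

open scoped Classical NumberField

namespace Summit.BirchSwinnertonDyer.Rank1Residual.X11b

open WeierstrassCurve NumberField IsDedekindDomain Field Literature.NumberTheory.EllipticCurves
  Literature.NumberTheory.EllipticCurves.ModularForms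
  Literature.NumberTheory.EllipticCurves.Rank1Residual
  Literature.NumberTheory.EllipticCurves.Rank1Residual.Typed
  Literature.NumberTheory.EllipticCurves.Wuthrich2014
  Literature.NumberTheory.EllipticCurves.SteinWuthrich2013
  Literature.NumberTheory.EllipticCurves.GreenbergVatsal2000
  Literature.NumberTheory.EllipticCurves.EmertonPollackWeston2006
  Literature.NumberTheory.QuadraticFields.Quadratic
  Literature.NumberTheory.GaloisRepresentations
  Summit.BirchSwinnertonDyer.Rank1Residual
  Summit.BirchSwinnertonDyer.Rank1Residual.X11b.Three.Koly
  Summit.BirchSwinnertonDyer.BirchSwinnertonDyer.Theorems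

/-! ### §0 «2 split ⟹ (2) not prime» -/

/-- **`2` split in `K` ⟹ `(2)` is not a prime ideal of `𝓞 K`** (the frame condition «2 not inert» of corner3-p2's Cha kernel, read off the
Heegner hypothesis at `2`): were `2𝓞_K` prime it would be maximal (Dedekind), hence the ONLY prime over `2`, contradicting «two primes over 2».
Elementary bookkeeping. -/
theorem not_isPrime_span_two_of_satisfiesHeegnerHypothesis {K : Type} [Field K] [NumberField K]
    (hH2 : SatisfiesHeegnerHypothesis 2 K) : ¬ (Ideal.span {((2 : ℕ) : 𝓞 K)}).IsPrime := by
  intro hP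
  have h2 : ((Ideal.span {(2 : ℤ)}).primesOver (𝓞 K)).ncard = 2 := hH2 2 Nat.prime_two (dvd_refl 2)
  set P : Ideal (𝓞 K) := Ideal.span {((2 : ℕ) : 𝓞 K)} with hPdef
  have h20 : ((2 : ℕ) : 𝓞 K) ≠ 0 := by exact_mod_cast (by norm_num : (2 : ℕ) ≠ 0)
  have hP0 : P ≠ ⊥ := by
    rw [hPdef]
    exact mt Ideal.span_singleton_eq_bot.mp h20
  have hPmax : P.IsMaximal := hP.isMaximal hP0
  -- every prime over `(2)` contains `2`, hence equals the maximal ideal `P`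
  have hsub : (Ideal.span {(2 : ℤ)}).primesOver (𝓞 K) ⊆ {P} := by
    intro Q hQ
    obtain ⟨hQprime, hQover⟩ := hQ
    have h2Q : ((2 : ℕ) : 𝓞 K) ∈ Q := by
      have hmem : (2 : ℤ) ∈ Ideal.comap (algebraMap ℤ (𝓞 K)) Q := by
        rw [← Ideal.under_def, ← hQover.over]
        exact Ideal.mem_span_singleton_self _
      simpa using hmem
    have hle : P ≤ Q := by
      rw [hPdef, Ideal.span_singleton_le_iff_mem]
      exact h2Q
    exact Set.mem_singleton_iff.mpr (hPmax.eq_of_le hQprime.ne_top hle).symm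
  have hle1 : ((Ideal.span {(2 : ℤ)}).primesOver (𝓞 K)).ncard ≤ 1 :=
    (Set.ncard_le_ncard hsub (Set.finite_singleton P)).trans (by rw [Set.ncard_singleton])
  omega

/-! ### §1 The sharp `K`-bound with Cha's conclusion supplied at the frame -/

/-- **UPPER: the sharp `K`-bound from global divisibility, with Cha's structure bound SUPPLIED AT THE FRAME.** lane A's
`shaIndexBound_sharp_of_globalDivisibility_of_irreducible` (module `…CornerAtThreeKolyvagin`) VERBATIM except that the named fact
`Cha2005.rmk25_padicValNat_card_sha_primary_add_le_of_globalDivisibility` is replaced by its CONCLUSION AT THIS FRAME as a hypothesis (`hCha`: for every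
exponent `M₀` with `p^{M₀} ∥ P` and every `t`, global `p^s`-divisibility of the derived points for `s ≤ t` gives `ord_p #Ш(E/K)[p^∞] + 2t ≤ 2M₀`) —
so that a KERNEL producer of that conclusion (corner3-p2 g11's `ModularHeegnerCha.cha_rmk25_upper_of_neg_of_casselsTate_of_frobeniusCongruence`) can be
plugged in. `W/ℚ` globally minimal; `K` a number field; a conductor-1 datum `d₁` on the frame `(Dt, β, ι)` with derived point `P ∈ E(K)` of infinite
order (the conductor-1 datum itself only enters through `hCha`); `E(K)` of rank one without `p`-torsion; `Ш(E/K)` finite: IF `M_∞ ≥ t` (`hglob`)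
THEN `ord_p #Ш(E/K) + 2t ≤ 2·ord_p [E(K):ℤP]`. Bookkeeping
(Mordell–Weil exponent `M₀`, `ord_p #Ш = ord_p #Ш[p^∞]`, `ord_p [E(K):ℤP] = M₀`); CONDITIONAL on `hCha`, `hglob`.
-- adapted from Summits/BirchSwinnertonDyer/BirchSwinnertonDyer/Theorems/ClassRecordThreeCornerAtThreeKolyvagin.lean
[cite: Cha2005, Thm. 21 and Rmk. 25 (pp. 173–175)] [cite: McCallumLMS1991, §5 Cor. 5.6 (p. 310) and Lemma 5.1 (p. 303)] -/
theorem shaIndexBound_sharp_of_globalDivisibility_of_chaAt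
    (W : WeierstrassCurve ℚ) [W.IsElliptic] [W.IsGloballyMinimal] [NeZero (W.conductorNorm ℤ)]
    (K : Type) [Field K] [NumberField K] (p : ℕ) [Fact p.Prime]
    (Dt : ModularParametrizationData W (W.conductorNorm ℤ)) (β : ℤ) (ι : K →+* ℂ)
    (P : (W.baseChange K).toAffine.Point)
    (hPinf : ¬ IsOfFinAddOrder P)
    (hrank : (W.baseChange K).mordellWeilRank = 1)
    (hiv : ∀ x : (W.baseChange K).toAffine.Point, p • x = 0 → x = 0)
    [Finite (W.baseChange K).sha]
    -- Cha's structure bound AT THIS FRAME (for the intended producer: at the derived point of a conductor-1 datum read as `P`), for every Mordell–Weil exponent `M₀` of `P` and every `t`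
    (hCha : ∀ (M₀ : ℕ),
      (∃ Q : (W.baseChange K).toAffine.Point, ((p ^ M₀ : ℕ) : ℤ) • Q = P) →
      (¬ ∃ Q : (W.baseChange K).toAffine.Point, ((p ^ (M₀ + 1) : ℕ) : ℤ) • Q = P) →
      ∀ (t : ℕ),
        (∀ (s : ℕ), s ≤ t → ∀ (n : ℕ) (d : KolyvaginHeegnerData Dt β ι n), Squarefree n →
          (∀ ℓ ∈ n.primeFactors, Zhang2014.IsKolyvaginPrime (W.conductorNorm ℤ) W K p ℓ ∧
            s ≤ Zhang2014.kolyvaginIndex W p ℓ) →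
          ∃ Q : (W.baseChange (ringClassField K ι n)).toAffine.Point,
            ((p ^ s : ℕ) : ℤ) • Q = d.derivedPoint) →
        padicValNat p (Nat.card (AddCommGroup.primaryComponent (W.baseChange K).sha p)) + 2 * t ≤ 2 * M₀)
    {t : ℕ}
    (hglob : ∀ (s : ℕ), s ≤ t → ∀ (n : ℕ) (d : KolyvaginHeegnerData Dt β ι n), Squarefree n →
      (∀ ℓ ∈ n.primeFactors, Zhang2014.IsKolyvaginPrime (W.conductorNorm ℤ) W K p ℓ ∧
        s ≤ Zhang2014.kolyvaginIndex W p ℓ) → PDiv d p s) :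
    padicValNat p (Nat.card (W.baseChange K).sha) + 2 * t ≤
      2 * padicValNat p (AddSubgroup.zmultiples P).index := by
  have hp : p.Prime := Fact.out
  -- the exponent p^{M₀} ∥ P (Mordell–Weil)
  haveI : Module.Finite ℤ (W.baseChange K).toAffine.Point := (W.baseChange K).module_finite_point_holds
  obtain ⟨M₀, x₀, hx₀, hmax⟩ := exists_pow_smul_eq_and_forall_ne hPinf (p := p) hp.two_le
  have hdiv : ∃ Q : (W.baseChange K).toAffine.Point, ((p ^ M₀ : ℕ) : ℤ) • Q = P :=
    ⟨x₀, by rw [natCast_zsmul]; exact hx₀⟩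
  have hndiv : ¬ ∃ Q : (W.baseChange K).toAffine.Point, ((p ^ (M₀ + 1) : ℕ) : ℤ) • Q = P := by
    rintro ⟨Q, hQ⟩
    exact hmax Q (by rw [← natCast_zsmul]; exact hQ)
  -- the structure bound at the frame, upper form
  have hle : padicValNat p (Nat.card (AddCommGroup.primaryComponent (W.baseChange K).sha p)) + 2 * t ≤
      2 * M₀ :=
    hCha M₀ hdiv hndiv t (fun s hs n d hn hℓ ↦ hglob s hs n d hn hℓ)
  -- `ord_p #Ш = ord_p #Ш[p^∞]` and `ord_p [E(K):ℤP] = M₀`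
  have hsha : padicValNat p (Nat.card (AddCommGroup.primaryComponent (W.baseChange K).sha p)) =
      padicValNat p (Nat.card (W.baseChange K).sha) :=
    padicValNat_card_addPrimaryComponent (A := (W.baseChange K).sha) p
  haveI : Finite (AddCommGroup.torsion (W.baseChange K).toAffine.Point) :=
    WeierstrassCurve.finite_torsion_point (W := W.baseChange K)
  obtain ⟨c, Q, hcQ, hcker⟩ := RankOne.exists_coord_of_mordellWeilRank_eq_one (W.baseChange K) hrank
  have hidx : padicValNat p (AddSubgroup.zmultiples P).index = M₀ :=
    padicValNat_index_zmultiples_eq_of_divisibility c Q hcQ hcker hiv P hdiv hndiv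
  rw [hidx, ← hsha]
  exact hle

/-! ### §2 The MAX road without Cha's fact -/

/-- **The corner's Euler-system half from Jₚᶜ on the MAX road — Cha 2005 Rmk. 25 (upper half) BY KERNEL.** This seat g3's
`missingUpperBoundAt_corner_of_jetchevDivisibility_of_twinLeafLower` (the X₀(N) MAX form: Friedberg–Hoffstein Heegner frame with `p` split,
Darmon's conductor-1 datum, x11b3's sharp descent with weight `t = ord_p ∏c`, the twin's `≥`-half at the non-surjective X11a leaf) with its ONE
structural named input `hChaU = Cha2005.rmk25_padicValNat_card_sha_primary_add_le_of_globalDivisibility` (flag `Cha05-Rmk25-structure`) REPLACED by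
lane B corner3-p2 g11's KERNEL theorem `ModularHeegnerCha.cha_rmk25_upper_of_neg_of_casselsTate_of_frobeniusCongruence` (p628321: Kolyvagin's
structure bound `ord_p #Ш(E/K)[p^∞] + 2t ≤ 2M₀` from {`casselsTate_levelInputs K`, Gross 3.7 (2) image-free} for every irreducible `E[p]` with
`−1 ∈ ρ̄_{E,p}(Γ_ℚ)`, on Heegner frames with `d_K ∉ {−3,−4}` and `2` not inert). The two extra frame conditions are met by construction:
`−1 ∈ ρ̄_{E,p}(Γ_ℚ)` at every multiplicative `p ≥ 5` with `E[p]` irreducible (`ShimuraKolyvaginOfImage.exists_smul_eq_neg_of_mult_of_irr_of_five_le`,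
image-free), and «2 not inert» by choosing the Friedberg–Hoffstein frame with `2` AND `p` split — the FINITE-SET form of Friedberg–Hoffstein's theorem
(`friedbergHoffstein_exists_heegnerField_splitDivisors_twist_ne_zero`, FH 1995 Thm. B as printed; it implies the one-prime form
`friedbergHoffstein_exists_heegnerField_split_twist_ne_zero` used before). Net: the named inputs are {GZ, Kolyvagin, GZK, modularity ×2, FH (finite-set),
Mazur 4.1, Darmon 3.7 ∕ 3.6 (both `_holds` upstream), `casselsTate_levelInputs`, Gross 3.7 (2)} — NO Cha fact. CONDITIONAL on the binders (`hLtw`, `hJ`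
hypothesis shapes as before); nothing booked.
[cite: Cha2005, Thm. 21 and Rmk. 25 (pp. 173–175)] [cite: MatarNekovar2019, Thm. 0.7, §0.9, §0.11] [cite: McCallumLMS1991, §5 Cor. 5.6]
[cite: GrossLMS1991, §3 Prop. 3.7 (2), §9 Prop. 9.3] [cite: FriedbergHoffstein1995, Thm. B] [cite: JetchevSkinnerWan2017, §7.4.1–7.4.2]
[cite: Jetchev2008, Thm. 1.1] [cite: Miller2011LMS, Def. 1.1] -/
theorem missingUpperBoundAt_corner_of_jetchevDivisibility_of_twinLeafLower_of_casselsTate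
    (hGZ : ∀ (N : ℕ) [NeZero N] (W : WeierstrassCurve ℚ) (K : Type) [Field K] [NumberField K],
      gross_zagier N W K)
    (hKo : ∀ (N : ℕ) [NeZero N] (W : WeierstrassCurve ℚ) (K : Type) [Field K] [NumberField K],
      kolyvagin N W K)
    (hGZK : rank_eq_analyticRank_of_analyticRank_le_one) (hmod : hasEntireLFunction_rat)
    (hnf : exists_isNewformOf) (hFHS : friedbergHoffstein_exists_heegnerField_splitDivisors_twist_ne_zero)
    (hMaz : mazur_not_dvd_maninConstant_of_odd)
    (hrec : ∀ (N : ℕ) [NeZero N] (W : WeierstrassCurve ℚ) (K : Type) [Field K] [NumberField K],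
      heegnerPointOfConductor_one_galoisConj N W K)
    (hD36 : ∀ (N : ℕ) [NeZero N] (W : WeierstrassCurve ℚ) (K : Type) [Field K] [NumberField K],
      phi_heegnerTau_mem_singularModuliField N W K)
    (hCT : ∀ (K : Type) [Field K] [NumberField K], casselsTate_levelInputs K)
    (h372 : GrossLMS1991.prop37_2_frobeniusCongruence)
    (W : WeierstrassCurve ℚ) [W.IsElliptic] [W.IsGloballyMinimal] (p : ℕ) [Fact p.Prime]
    (hX : ClassX11b W p) (hns : ¬ Surj W p) (h57 : p = 5 ∨ p = 7)
    (hv : p ∣ padicValInt p W.minimalDiscriminantInt) (hnr : ¬ Ram W p)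
    -- the `≥`-half of the NON-SURJECTIVE X11a leaf twins at this `p` (hypothesis shape)
    (hLtw : ∀ (Wd : WeierstrassCurve ℚ) [Wd.IsElliptic] [Wd.IsGloballyMinimal],
      ClassX11a Wd p → ¬ Surj Wd p → p ∣ padicValInt p Wd.minimalDiscriminantInt →
      Typed.MissingLowerBoundAt Wd p)
    -- Jₚᶜ: the Jetchev direction `M_∞ ≥ t` on the corner frames of THIS pair (hypothesis shape)
    (hJ : ∀ [NeZero (W.conductorNorm ℤ)] (K : Type) [Field K] [NumberField K]
      (Dt : ModularParametrizationData W (W.conductorNorm ℤ)) (β : ℤ) (ι : K →+* ℂ),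
      IsImaginaryQuadratic K → 4 < (NumberField.discr K).natAbs →
      SatisfiesHeegnerHypothesis (W.conductorNorm ℤ) K → SatisfiesHeegnerHypothesis p K →
      (4 * (W.conductorNorm ℤ : ℤ)) ∣ β ^ 2 - NumberField.discr K → ¬ (p : ℤ) ∣ Dt.c →
      ∀ (s : ℕ), s ≤ padicValNat p W.tamagawaProduct →
        ∀ (n : ℕ) (d : KolyvaginHeegnerData Dt β ι n), Squarefree n →
          (∀ ℓ ∈ n.primeFactors, Zhang2014.IsKolyvaginPrime (W.conductorNorm ℤ) W K p ℓ ∧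
            s ≤ Zhang2014.kolyvaginIndex W p ℓ) → PDiv d p s) :
    Typed.MissingUpperBoundAt W p := by
  have hNS : integral_neronScaling_of_isGloballyMinimal :=
    integral_neronScaling_of_isGloballyMinimal_holds
  haveI : NeZero (W.conductorNorm ℤ) := ⟨(W.conductorNorm_pos_holds).ne'⟩
  have hp : p.Prime := Fact.out
  have hp5 : 5 ≤ p := by rcases h57 with h | h <;> omega
  have hp2 : p ≠ 2 := by omega
  obtain ⟨hr, _, hmult, hirr⟩ := id hX
  -- a Manin-good parametrisation of level N_E (p² ∤ N)
  have hpN : ¬ p ^ 2 ∣ W.conductorNorm ℤ := not_sq_dvd_conductorNorm_of_mult W p hmult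
  obtain ⟨D, hc⟩ := exists_modularParametrizationData_not_dvd hnf hMaz hNS W rfl hp hp2 hpN hirr
  -- the Friedberg–Hoffstein Heegner field: |d_K| > 4, every ℓ ∣ N_E and p split, L(E^{d_K},1) ≠ 0
  have hw : W.rootNumber = -1 := by
    rw [WeierstrassCurve.rootNumber_eq_neg_one_pow_analyticRank_of_exists_isNewformOf hnf W, hr]
    norm_num
  -- the frame is chosen with `2` split as well (finite-set Friedberg–Hoffstein): «2 not inert in K» for corner3-p2's Cha kernel
  obtain ⟨K, _, _, hK, hdisc, hHN, hHp, hH2, hLt⟩ :=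
    exists_heegnerField_split_two_primes_twist_ne_zero hFHS W hw hp Nat.prime_two 4
  have h2K : ¬ (Ideal.span {((2 : ℕ) : 𝓞 K)}).IsPrime := not_isPrime_span_two_of_satisfiesHeegnerHypothesis hH2
  haveI : IsTotallyComplex K := hK.2
  have hneg : NumberField.discr K < 0 := discr_neg_of_finrank_eq_two K hK.1
  have h4lt : NumberField.discr K < -4 := by
    have habs : ((NumberField.discr K).natAbs : ℤ) = -NumberField.discr K :=
      Int.ofNat_natAbs_of_nonpos hneg.le
    have : (4 : ℤ) < ((NumberField.discr K).natAbs : ℤ) := by exact_mod_cast hdisc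
    omega
  have h3 : NumberField.discr K ≠ -3 := by omega
  have h4 : NumberField.discr K ≠ -4 := by omega
  have hμ : ¬ p ∣ Units.torsionOrder K := by
    rw [Literature.NumberTheory.DiophantineGeometry.torsionOrder_eq_two_of_discr_lt hK.1 h4lt]
    intro h2
    have := Nat.le_of_dvd two_pos h2
    omega
  obtain ⟨H, -⟩ := nonempty_heegnerDatum_holds (W.conductorNorm ℤ) K hK
    (exists_dvd_sq_sub_discr_holds (W.conductorNorm ℤ) K hK hHN).choose_spec
  obtain ⟨ι⟩ : Nonempty (K →+* ℂ) := inferInstance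
  obtain ⟨P, hP⟩ := heegnerPointComplex_mem_range_map_holds (W.conductorNorm ℤ) W K hK hHN D H ι
  -- the minimal twist model: an X11a pair ON THE NON-SURJECTIVE LEAF, and its `≥`-half
  have hD0 : (NumberField.discr K : ℚ) ≠ 0 := by exact_mod_cast NumberField.discr_ne_zero K
  haveI hEt : (W.quadraticTwist (NumberField.discr K : ℚ)).IsElliptic :=
    W.isElliptic_quadraticTwist hD0
  obtain ⟨Cd, hCd⟩ := hasGlobalMinimalModel_rat_holds (W.quadraticTwist (NumberField.discr K : ℚ))
  haveI : (Cd • W.quadraticTwist (NumberField.discr K : ℚ)).IsGloballyMinimal := hCd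
  set Wd := Cd • W.quadraticTwist (NumberField.discr K : ℚ) with hWd_def
  have hWd : Cd • W.quadraticTwist (NumberField.discr K : ℚ) = Wd := rfl
  have hrd : Wd.analyticRank = 0 := by
    rw [hWd_def, analyticRank_smul]
    exact analyticRank_eq_zero_of_entireLFunction_one_ne_zero _ hLt
  have hXa : ClassX11a Wd p := classX11a_twist_of_not_ram W p hX hnr K hK hHN Cd hWd hrd
  have hirrd : Wd.HasIrreducibleModPGaloisRep p := hXa.2.2.2.1
  have hnsd : ¬ Surj Wd p := not_surj_twist_model W p hD0 hns Cd hWd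
  have hpN1 : p ∣ W.conductorNorm ℤ := dvd_conductorNorm_of_mult hmult
  have hsq := isSquare_discr_padic_of_heegner K hK hHN p hpN1
  have hvd : p ∣ padicValInt p Wd.minimalDiscriminantInt := by
    rw [padicValInt_minimalDiscriminantInt_twist_eq W p hD0 hsq Cd hWd]
    exact hv
  obtain ⟨qd, hqd, hvqd⟩ :=
    AdditivePotMult.exists_printShape_lower_of_missingLowerBoundAt_rankZero (p := p) Wd hGZK hrd hirrd
      (hLtw Wd hXa hnsd hvd)
  have htam : padicValNat p Wd.tamagawaProduct = padicValNat p W.tamagawaProduct :=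
    padicValNat_tamagawaProduct_twist_of_heegner W p hp5 K hK hHN Cd hWd
  have hu : padicValRat p (Cd.u : ℚ) = 0 :=
    AdditivePotMult.padicValRat_u_eq_zero_of_twist_minimal_of_split W p K hK hHp Cd hWd
  -- no p-torsion over K (irreducibility)
  have hbot := torsionBy_eq_bot_of_isImaginaryQuadratic_of_hasIrreducibleModPGaloisRep W K hK hp hirr
  have hiv : ∀ x : (W.baseChange K).toAffine.Point, p • x = 0 → x = 0 := fun x hx ↦ by
    have hmem : x ∈ AddSubgroup.torsionBy (W.baseChange K).toAffine.Point ((p : ℕ) : ℤ) := by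
      rw [mem_torsionBy_iff, natCast_zsmul]
      exact hx
    rw [hbot] at hmem
    exact hmem
  -- Darmon's conductor-1 datum on the frame (D, H.β, ι) and its bottom point
  obtain ⟨d₁⟩ := exists_kolyvaginHeegnerData_one (hD36 _ W K) hK D H.β ι H.dvd_sq_sub
  have hPd : d₁.toGeomPoints d₁.derivedPoint = toGeomPoints (W.baseChange K) P :=
    KolyvaginBottom.toGeomPoints_derivedPoint_one_eq (hrec _ W K) hK hHN hP d₁ rfl
  -- descent to ℚ with weight t = ord_p ∏c (x11b3's sharp bookkeeping)
  refine missingUpperBoundAt_of_shaIndexBound_sharp W p (W.conductorNorm ℤ) K D H ι P (hGZ _ W K)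
    (hKo _ W K) hGZK hmod hK hHN hP hp2 hc hμ hr hLt Wd Cd hWd hu htam le_rfl ⟨qd, hqd, hvqd⟩ ?_
  intro hfinK hPinf
  haveI : Finite (W.baseChange K).sha := hfinK
  obtain ⟨hrank, -⟩ := hKo (W.conductorNorm ℤ) W K hK hHN ⟨D, H, ι, hP⟩ hPinf
  -- `−1 ∈ ρ̄_{E,p}(Γ_ℚ)` at the multiplicative `p ≥ 5` with `E[p]` irreducible (image-free), then Cha Rmk. 25 BY KERNEL at this frame
  have hneg : ∃ γ : absoluteGaloisGroup ℚ, ∀ T : geomTorsion W p, γ • T = -T :=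
    ShimuraKolyvaginOfImage.exists_smul_eq_neg_of_mult_of_irr_of_five_le W p hp5 hmult hirr
  exact shaIndexBound_sharp_of_globalDivisibility_of_chaAt W K p D H.β ι P hPinf hrank hiv
    (fun M₀ hM₀div hM₀max t hglob ↦
      ModularHeegnerCha.cha_rmk25_upper_of_neg_of_casselsTate_of_frobeniusCongruence (hCT K) h372 hK h3 h4 hHN h2K hp2
        hpN1 hirr hneg ι D d₁ hPd hPinf hM₀div hM₀max t hglob)
    (hJ K D H.β ι hK hdisc hHN hHp H.dvd_sq_sub hc)


end Summit.BirchSwinnertonDyer.Rank1Residual.X11b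

end
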